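import Summits.Ventures.CertifiedArithmetic.LowPrec.GemmEnvelopeDecomposition

/-!
# GEMM-level envelopes, part (n): the two-sided pipeline bracket — row decisions survive accumulation
(pub-lowprec gemm gen 22, LXX-n)

HONEST FRAMING: certified error envelopes and provably optimal rounding/accumulation schemes for
low-precision formats under stated cost models; every table by two implementations; no hardware or
vendor claims.

E-DEC (part (a)) bounds the full-pipeline error from ABOVE.  The decision-table rows of parts (d)–(m) are
decided at the quantiser level (exact accumulation); this file records the elementary two-sided companion
that carries them to any accumulation / output model: with operand quantisation `|qa - a| ≤ ua|a|`,
`|qb - b| ≤ ub|b|`, accumulation `|acc - ΣΣ qa qb| ≤ γ·ΣΣ|qa qb|` and output rounding `|c - acc| ≤ δ|acc|`,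
the full-pipeline error and the quantisation error differ by at most `Γ·L`,
`Γ = (γ + δ(1+γ))·(1+ua)(1+ub)`, `L = ΣΣ|ab|` (`pipeline_bracket`).  Hence a tie row `quantisation error
≤ E·L` gives `full error ≤ (E + Γ)·L` (`pipeline_le_of_quant`), and a separating witness with
quantiser-level margin `> Γ` stays separating: `(E + Γ)·L < |quantisation error| ⇒ E·L < |full error|`
(`pipeline_fails_of_gap`); two configurations compared through their own pipelines need the margin to
exceed `Γ_X + Γ_Y` (`row_survives_pipelines`).  Orders of magnitude (cert GEMM-ENVELOPES-ROBUST.json, 72 rows,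
410 checks, two implementations of the realised pipelines with 0 diff): two-level Binary32 accumulation,
`K = 4096 = 128·32`, per-element `ua = ub = 1/8` (valid for MX / per-vector E4M3 on `C(κ)`, `κ ≤ 28672`):
`Γ ≈ 1.2·10⁻⁵` with Binary32 output, `≈ 4.9·10⁻³` with BFloat16 output (`gamma_P5_bf16_numeric`) — against
quantiser-level margins `≈ 1.7·10⁻²` (rows P3, P5 at `κ ≥ 16384`, P5x at `κ ≈ 30582`; certified for every
realisation, BFloat16 output included), `2.6·10⁻³` (P5 / P5x witnesses deep in the sliver: certified with
Binary32 output, realised but not certified with BFloat16 output) and `→ 0` as `κ ↓ θ` (quantiser level only).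
[cite: Higham2002ASNA, §3.1]; [cite: RouhaniEtAl2023MX, §6.3]
-/

namespace Summit.Ventures.CertifiedArithmetic.LowPrec.GemmEnvelope

open Finset

/-- The blocked reference mass of the accumulator: `ΣΣ|qa qb| ≤ (1+ua)(1+ub)·ΣΣ|ab|`.
[cite: Higham2002ASNA, §3.1] -/
theorem sum_sum_abs_mul_le {B k : ℕ} {a b qa qb : Fin B → Fin k → ℚ} {ua ub : ℚ}
    (hqa : ∀ j i, |qa j i - a j i| ≤ ua * |a j i|) (hqb : ∀ j i, |qb j i - b j i| ≤ ub * |b j i|) :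
    ∑ j, ∑ i, |qa j i * qb j i| ≤ (1 + ua) * (1 + ub) * ∑ j, ∑ i, |a j i * b j i| := by
  rw [mul_sum]
  exact sum_le_sum fun j _ => sum_abs_mul_le (hqa j) (hqb j)

/-- **THE TWO-SIDED PIPELINE BRACKET.** The full-pipeline error `|c - ΣΣ ab|` and the quantisation error
`|ΣΣ qa qb - ΣΣ ab|` differ by at most `(γ + δ(1+γ))·(1+ua)(1+ub)·ΣΣ|ab|`. [cite: Higham2002ASNA, §3.1] -/
theorem pipeline_bracket {B k : ℕ} (a b qa qb : Fin B → Fin k → ℚ) {ua ub γ δ acc c : ℚ}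
    (hγ : 0 ≤ γ) (hδ : 0 ≤ δ)
    (hqa : ∀ j i, |qa j i - a j i| ≤ ua * |a j i|) (hqb : ∀ j i, |qb j i - b j i| ≤ ub * |b j i|)
    (hacc : |acc - ∑ j, ∑ i, qa j i * qb j i| ≤ γ * ∑ j, ∑ i, |qa j i * qb j i|)
    (hc : |c - acc| ≤ δ * |acc|) :
    abs (|c - ∑ j, ∑ i, a j i * b j i| - |∑ j, ∑ i, qa j i * qb j i - ∑ j, ∑ i, a j i * b j i|)
      ≤ (γ + δ * (1 + γ)) * ((1 + ua) * (1 + ub)) * ∑ j, ∑ i, |a j i * b j i| := by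
  set S : ℚ := ∑ j, ∑ i, a j i * b j i with hS
  set Q : ℚ := ∑ j, ∑ i, qa j i * qb j i with hQ
  set Lq : ℚ := ∑ j, ∑ i, |qa j i * qb j i| with hLq
  set L : ℚ := ∑ j, ∑ i, |a j i * b j i| with hL
  have hQle : |Q| ≤ Lq :=
    le_trans (abs_sum_le_sum_abs _ _) (sum_le_sum fun j _ => abs_sum_le_sum_abs _ _)
  have hLq0 : 0 ≤ Lq := le_trans (abs_nonneg _) hQle
  have hLqL : Lq ≤ (1 + ua) * (1 + ub) * L := sum_sum_abs_mul_le hqa hqb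
  have hcQ : |c - Q| ≤ (γ + δ * (1 + γ)) * Lq := by
    have h1 : |acc| ≤ Lq + γ * Lq := by
      have := abs_sub_abs_le_abs_sub acc Q
      linarith
    have h2 : |c - acc| ≤ δ * (Lq + γ * Lq) := le_trans hc (mul_le_mul_of_nonneg_left h1 hδ)
    calc |c - Q| = |(c - acc) + (acc - Q)| := by ring_nf
      _ ≤ |c - acc| + |acc - Q| := abs_add_le _ _
      _ ≤ δ * (Lq + γ * Lq) + γ * Lq := add_le_add h2 hacc
      _ = (γ + δ * (1 + γ)) * Lq := by ring
  have key : abs (|c - S| - |Q - S|) ≤ |c - Q| := by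
    have := abs_abs_sub_abs_le_abs_sub (c - S) (Q - S)
    rwa [show c - S - (Q - S) = c - Q by ring] at this
  have hcoef : 0 ≤ γ + δ * (1 + γ) := by positivity
  calc abs (|c - S| - |Q - S|) ≤ |c - Q| := key
    _ ≤ (γ + δ * (1 + γ)) * Lq := hcQ
    _ ≤ (γ + δ * (1 + γ)) * ((1 + ua) * (1 + ub) * L) := mul_le_mul_of_nonneg_left hLqL hcoef
    _ = (γ + δ * (1 + γ)) * ((1 + ua) * (1 + ub)) * L := by ring

/-- TIE ROWS SURVIVE: a quantiser-level bound `E·L` becomes the full-pipeline bound `(E + Γ)·L`,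
`Γ = (γ + δ(1+γ))(1+ua)(1+ub)`. [cite: Higham2002ASNA, §3.1] -/
theorem pipeline_le_of_quant {B k : ℕ} (a b qa qb : Fin B → Fin k → ℚ) {ua ub γ δ acc c E : ℚ}
    (hγ : 0 ≤ γ) (hδ : 0 ≤ δ)
    (hqa : ∀ j i, |qa j i - a j i| ≤ ua * |a j i|) (hqb : ∀ j i, |qb j i - b j i| ≤ ub * |b j i|)
    (hacc : |acc - ∑ j, ∑ i, qa j i * qb j i| ≤ γ * ∑ j, ∑ i, |qa j i * qb j i|)
    (hc : |c - acc| ≤ δ * |acc|)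
    (hE : |∑ j, ∑ i, qa j i * qb j i - ∑ j, ∑ i, a j i * b j i| ≤ E * ∑ j, ∑ i, |a j i * b j i|) :
    |c - ∑ j, ∑ i, a j i * b j i|
      ≤ (E + (γ + δ * (1 + γ)) * ((1 + ua) * (1 + ub))) * ∑ j, ∑ i, |a j i * b j i| := by
  have h := pipeline_bracket a b qa qb hγ hδ hqa hqb hacc hc
  rw [abs_le] at h
  linarith [h.2]

/-- SEPARATIONS SURVIVE WITH MARGIN: a witness whose quantisation error exceeds `(E + Γ)·L` has
full-pipeline error exceeding `E·L`, whatever the accumulation / output realisation within the model.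
[cite: Higham2002ASNA, §3.1] -/
theorem pipeline_fails_of_gap {B k : ℕ} (a b qa qb : Fin B → Fin k → ℚ) {ua ub γ δ acc c E : ℚ}
    (hγ : 0 ≤ γ) (hδ : 0 ≤ δ)
    (hqa : ∀ j i, |qa j i - a j i| ≤ ua * |a j i|) (hqb : ∀ j i, |qb j i - b j i| ≤ ub * |b j i|)
    (hacc : |acc - ∑ j, ∑ i, qa j i * qb j i| ≤ γ * ∑ j, ∑ i, |qa j i * qb j i|)
    (hc : |c - acc| ≤ δ * |acc|)
    (hgap : (E + (γ + δ * (1 + γ)) * ((1 + ua) * (1 + ub))) * ∑ j, ∑ i, |a j i * b j i|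
      < |∑ j, ∑ i, qa j i * qb j i - ∑ j, ∑ i, a j i * b j i|) :
    E * ∑ j, ∑ i, |a j i * b j i| < |c - ∑ j, ∑ i, a j i * b j i| := by
  have h := pipeline_bracket a b qa qb hγ hδ hqa hqb hacc hc
  rw [abs_le] at h
  linarith [h.1]

/-- A ROW SURVIVES BOTH PIPELINES: if configuration X obeys the quantiser-level envelope `E` on the input
(`|Q_X - S| ≤ E·L`) and configuration Y's quantisation error on its witness exceeds `(E + Γ_X + Γ_Y)·L'`,
then X's full-pipeline error bound `(E + Γ_X)·L` is beaten by Y's full-pipeline error relative to `L'`: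
`|c_X - S| ≤ (E + Γ_X)·L` and `(E + Γ_X)·L' < |c_Y - S'|`.  (Stated for one input of each configuration;
the row quantifies over X's class and exhibits Y's witness.) [cite: Higham2002ASNA, §3.1] -/
theorem row_survives_pipelines {B k B' k' : ℕ}
    (a b qa qb : Fin B → Fin k → ℚ) (a' b' qa' qb' : Fin B' → Fin k' → ℚ)
    {ua ub γ δ acc c ua' ub' γ' δ' acc' c' E : ℚ}
    (hγ : 0 ≤ γ) (hδ : 0 ≤ δ) (hγ' : 0 ≤ γ') (hδ' : 0 ≤ δ')
    (hqa : ∀ j i, |qa j i - a j i| ≤ ua * |a j i|) (hqb : ∀ j i, |qb j i - b j i| ≤ ub * |b j i|)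
    (hacc : |acc - ∑ j, ∑ i, qa j i * qb j i| ≤ γ * ∑ j, ∑ i, |qa j i * qb j i|)
    (hc : |c - acc| ≤ δ * |acc|)
    (hE : |∑ j, ∑ i, qa j i * qb j i - ∑ j, ∑ i, a j i * b j i| ≤ E * ∑ j, ∑ i, |a j i * b j i|)
    (hqa' : ∀ j i, |qa' j i - a' j i| ≤ ua' * |a' j i|)
    (hqb' : ∀ j i, |qb' j i - b' j i| ≤ ub' * |b' j i|)
    (hacc' : |acc' - ∑ j, ∑ i, qa' j i * qb' j i| ≤ γ' * ∑ j, ∑ i, |qa' j i * qb' j i|)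
    (hc' : |c' - acc'| ≤ δ' * |acc'|)
    (hgap : (E + (γ + δ * (1 + γ)) * ((1 + ua) * (1 + ub))
        + (γ' + δ' * (1 + γ')) * ((1 + ua') * (1 + ub'))) * ∑ j, ∑ i, |a' j i * b' j i|
      < |∑ j, ∑ i, qa' j i * qb' j i - ∑ j, ∑ i, a' j i * b' j i|) :
    |c - ∑ j, ∑ i, a j i * b j i|
        ≤ (E + (γ + δ * (1 + γ)) * ((1 + ua) * (1 + ub))) * ∑ j, ∑ i, |a j i * b j i| ∧
      (E + (γ + δ * (1 + γ)) * ((1 + ua) * (1 + ub))) * ∑ j, ∑ i, |a' j i * b' j i|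
        < |c' - ∑ j, ∑ i, a' j i * b' j i| := by
  refine ⟨pipeline_le_of_quant a b qa qb hγ hδ hqa hqb hacc hc hE, ?_⟩
  refine pipeline_fails_of_gap a' b' qa' qb' hγ' hδ' hqa' hqb' hacc' hc' ?_
  have e : (E + (γ + δ * (1 + γ)) * ((1 + ua) * (1 + ub)) + (γ' + δ' * (1 + γ')) * ((1 + ua') * (1 + ub')))
      = (E + (γ + δ * (1 + γ)) * ((1 + ua) * (1 + ub))) + (γ' + δ' * (1 + γ')) * ((1 + ua') * (1 + ub')) := by
    ring
  rw [e, add_mul] at hgap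
  have e2 : (E + (γ + δ * (1 + γ)) * ((1 + ua) * (1 + ub))) + (γ' + δ' * (1 + γ')) * ((1 + ua') * (1 + ub'))
      = ((E + (γ + δ * (1 + γ)) * ((1 + ua) * (1 + ub))) + (γ' + δ' * (1 + γ')) * ((1 + ua') * (1 + ub'))) := rfl
  linarith

/-- Numeric face (row P5 at `κ ≥ 16384`, two-level Binary32 accumulation with `K = 128·32`, BFloat16
output `δ = 1/257`, per-element `ua = ub = 1/8`): `Γ = (γ + δ(1+γ))·(9/8)² < 1/200` for
`γ = 31/16777217 + 127/16777217·(1 + 31/16777217)`, and twice that is below the quantiser-level margin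
`1084/65025 = 31/225 - 35/289`. [cite: RouhaniEtAl2023MX, §6.3] -/
theorem gamma_P5_bf16_numeric :
    ((31 : ℚ) / 16777217 + 127 / 16777217 * (1 + 31 / 16777217)
        + 1 / 257 * (1 + (31 / 16777217 + 127 / 16777217 * (1 + 31 / 16777217)))) * ((1 + 1 / 8) * (1 + 1 / 8))
      < 1 / 200 ∧
    2 * ((1 : ℚ) / 200) < 31 / 225 - 35 / 289 := by
  constructor <;> norm_num

end Summit.Ventures.CertifiedArithmetic.LowPrec.GemmEnvelope
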